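import Literature.AlgebraicGeometry.Resolution.PointCentreFibreLine
import Literature.AlgebraicGeometry.Resolution.PointCentreFibreLineSwitch
import HarnessLib

/-!
# The fibre line of a point blow-up at `τ = 1`: the residue field of the near point is `k(x)[t̄]`

Topic: `Literature/AlgebraicGeometry/Resolution`; sequel of `PointCentreFibreLine.lean` (ring engine of the
`τ = 1` point step) and `PointCentreFibreLineSwitch.lean` (switch `u₂`-chart → `u₁`-chart). [CoP1] Lemma 4.5 (2)
and CJS Lemma 14.8 use, at a NON-RATIONAL near point `x′` of the `u_j`-chart, that the residue field
`k(x′)` is generated over `k(x)` by the residue `t̄` of `t = u_l/u_j`: every element of `k(x′)` is the residue of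
`G(t)` for a polynomial `G ∈ 𝒪_{X,x}[T]` (`k(x′) = k(x)[T]/(P̄) = k(x)[t̄]`). This is the extra input binder
`hκ` of the non-rational step theorem (res-inputs-p-8a, B6-nr); it holds because `x′` is a CLOSED point of the
chart `Spec B_j`, `B_j/𝔪B_j = k[T₀, T_l]`, with `ȳ = T₀ = 0` there: `B_j/𝔴` is a quotient of `k[T]`, a field, and
`𝒪_{x′} = (B_j)_𝔴` has the same residue field.

* `pointCentre_chart_residueField_generated` — ring level, any chart presentation as in
  `pointCentre_chart_dichotomy`: `∀ r ∈ k(R′), ∃ G ∈ R[T], r = residue (G(χ e_l))`;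
* `residueField_generated_of_inv` — transport of this property from `s` to `t = s⁻¹` when `P′(t) ∈ 𝔪′` for a
  polynomial `P′` with unit constant term (`s ≡ −P′(0)⁻¹·(P′ div T)(t)`);
* `chartSwitch_nonRational'` — `chartSwitch_nonRational` carrying the property along.

Everything is PROVED (no `sorry`, no definitions, no named facts); OURS. F-71 / T1 NOT proved; no summit
statement proved. AI-written; weaker than expert review.

## Sources

* V. Cossart, O. Piltant, J. Algebra 320 (2008), Lemma 4.3 (5), Lemma 4.5 (2) ((23)–(25)). [CossartPiltant2008]
* V. Cossart, U. Jannsen, S. Saito, LNM 2270 (2020), Lemma 14.1, Lemma 14.8. [CossartJannsenSaito2020]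
* The Stacks Project, Tag 0804. [StacksProject]
-/

noncomputable section

open IsLocalRing

namespace Literature.AlgebraicGeometry.Resolution

universe u

set_option maxHeartbeats 800000 in
-- same chart computation as `pointCentre_chart_dichotomy` (its line map `θ` is rebuilt here)
/-- **`k(R′) = k(R)[t̄]` at a closed point of the line `{Y₀ = 0}`, chart `u_j ≠ 0` (ring level).** In the
situation of `pointCentre_chart_dichotomy` (`χ : B_j → R′` a chart presentation at a prime `𝔴 ∋ e₀` over `𝔪`,
`spanFinrank 𝔪_{R′} = 3`): every element of the residue field of `R′` is the residue of `G(χ e_l)` for some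
`G ∈ R[T]`. [cite: CossartPiltant2008, Lemma 4.5 (2)] [cite: CossartJannsenSaito2020, Lemma 14.8] -/
theorem pointCentre_chart_residueField_generated {R R' : Type u} [CommRing R] [IsLocalRing R] [CommRing R']
    [IsLocalRing R'] (hd' : (maximalIdeal R').spanFinrank = 3)
    {c : Fin 3 → R} (hc : Ideal.span (Set.range c) = maximalIdeal R) (hcq : IsQuasiRegular c)
    {j l : Fin 3} (hj0 : j ≠ 0) (hl : l ≠ j) (hl0 : l ≠ 0)
    (hι : ∀ i : {i : Fin 3 // i ≠ j}, i.1 ≠ 0 → i = ⟨l, hl⟩)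
    (φ : R →+* R') (𝔴 : Ideal (chartRing c j)) [𝔴.IsPrime]
    (χ : chartRing c j →+* R') (hχ : ∀ a, χ (chartBase c j a) = φ a)
    (hloc : @IsLocalization.AtPrime _ _ R' _ χ.toAlgebra 𝔴 _)
    (h𝔴 : 𝔴.comap (chartBase c j) = maximalIdeal R) (he0 : chartGen c j 0 ∈ 𝔴) :
    ∀ r : ResidueField R', ∃ G : Polynomial R, residue R' (Polynomial.eval₂ φ (χ (chartGen c j l)) G) = r := by
  classical
  letI := χ.toAlgebra
  haveI : IsLocalization.AtPrime R' 𝔴 := hloc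
  have hcm : ∀ i, c i ∈ maximalIdeal R := fun i => hc ▸ Ideal.subset_span ⟨i, rfl⟩
  have h𝔴' : (maximalIdeal R).map (chartBase c j) ≤ 𝔴 := by rw [← h𝔴]; exact Ideal.map_comap_le
  have hmB : (maximalIdeal R).map (chartBase c j) = Ideal.span {chartBase c j (c j)} := by
    rw [← hc]; exact Ideal.map_span_range_eq_span_singleton _ c j _ (reesChartBase_apply_eq_mul_chartGen c j)
  have hcj𝔴 : chartBase c j (c j) ∈ 𝔴 := h𝔴' (Ideal.mem_map_of_mem _ (hcm j))
  have hχm : ∀ b, χ b ∈ maximalIdeal R' ↔ b ∈ 𝔴 := fun b =>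
    IsLocalization.AtPrime.to_map_mem_maximal_iff R' 𝔴 b
  have h𝔪' : maximalIdeal R' = 𝔴.map χ := (IsLocalization.AtPrime.map_eq_maximalIdeal 𝔴 R').symm
  -- STEP 1: the fibre chart `ρ : B_j → k[T_i : i ≠ j]` and the line map `θ : B_j → k[T]`
  obtain ⟨ρ, hρsurj, hρker, hρF⟩ :
      ∃ ρ : chartRing c j →+* MvPolynomial {i : Fin 3 // i ≠ j} (ResidueField R),
        Function.Surjective ρ ∧ RingHom.ker ρ = (maximalIdeal R).map (chartBase c j) ∧
        ∀ F : MvPolynomial (Fin 3) R,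
          ρ (MvPolynomial.eval₂Hom (chartBase c j) (fun i => chartGen c j i) F) =
            MvPolynomial.map (residue R) (dehomogenize j F) :=
    exists_chartResidueMap c j hcq hcm
  let κ : MvPolynomial {i : Fin 3 // i ≠ j} (ResidueField R) →ₐ[ResidueField R]
      Polynomial (ResidueField R) :=
    MvPolynomial.aeval fun i => if i.1 = 0 then 0 else Polynomial.X
  have hκ0 : κ (MvPolynomial.X ⟨0, hj0.symm⟩) = 0 := by simp [κ]
  have hκl : κ (MvPolynomial.X ⟨l, hl⟩) = Polynomial.X := by simp [κ, hl0]
  have hκC : ∀ a, κ (MvPolynomial.C a) = Polynomial.C a := fun a => by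
    rw [MvPolynomial.algHom_C, Polynomial.algebraMap_eq]
  let θ : chartRing c j →+* Polynomial (ResidueField R) := κ.toRingHom.comp ρ
  have hρC : ∀ r, ρ (chartBase c j r) = MvPolynomial.C (residue R r) := fun r => by
    have h := hρF (MvPolynomial.C r)
    rw [MvPolynomial.coe_eval₂Hom, MvPolynomial.eval₂_C, MvPolynomial.algHom_C, MvPolynomial.algebraMap_eq,
      MvPolynomial.map_C] at h
    exact h
  have hρX : ∀ (i : Fin 3) (hi : i ≠ j), ρ (chartGen c j i) = MvPolynomial.X ⟨i, hi⟩ := fun i hi => by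
    have h := hρF (MvPolynomial.X i)
    rw [MvPolynomial.coe_eval₂Hom, MvPolynomial.eval₂_X] at h
    rw [h, MvPolynomial.aeval_X, killVar_of_ne j hi, MvPolynomial.map_X]
  have hθC : ∀ r, θ (chartBase c j r) = Polynomial.C (residue R r) := fun r => by
    show κ (ρ (chartBase c j r)) = _
    rw [hρC, hκC]
  have hθl : θ (chartGen c j l) = Polynomial.X := by
    show κ (ρ (chartGen c j l)) = _
    rw [hρX l hl, hκl]
  have hθG : ∀ G : Polynomial R,
      θ (Polynomial.eval₂ (chartBase c j) (chartGen c j l) G) = G.map (residue R) := fun G => by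
    rw [Polynomial.hom_eval₂, hθl]
    have : θ.comp (chartBase c j) = Polynomial.C.comp (residue R) := RingHom.ext hθC
    rw [this, ← Polynomial.eval₂_map, Polynomial.eval₂_C_X]
  have hθsurj : Function.Surjective θ := by
    intro q
    obtain ⟨G, hG⟩ := Polynomial.map_surjective (residue R) residue_surjective q
    exact ⟨Polynomial.eval₂ (chartBase c j) (chartGen c j l) G, by rw [hθG, hG]⟩
  -- `ker θ ⊆ (c_j, e₀) ⊆ 𝔴`
  have hkerθ : ∀ b, θ b = 0 → b ∈ Ideal.span {chartBase c j (c j), chartGen c j 0} := by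
    intro b hb
    have h1 := sub_rename_kill_mem_span_X hj0 hl κ hκ0 hκl hι (ρ b)
    have hb' : κ (ρ b) = 0 := hb
    rw [hb', map_zero, sub_zero] at h1
    have hmap : Ideal.span {(MvPolynomial.X ⟨0, hj0.symm⟩ :
        MvPolynomial {i : Fin 3 // i ≠ j} (ResidueField R))} = (Ideal.span {chartGen c j 0}).map ρ := by
      rw [Ideal.map_span, Set.image_singleton, hρX 0 hj0.symm]
    rw [hmap] at h1
    have h2 : b ∈ ((Ideal.span {chartGen c j 0}).map ρ).comap ρ := Ideal.mem_comap.mpr h1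
    rw [Ideal.comap_map_of_surjective ρ hρsurj, ← RingHom.ker_eq_comap_bot, hρker, hmB] at h2
    rw [Ideal.span_insert, sup_comm]
    exact h2
  have hspan𝔴 : Ideal.span {chartBase c j (c j), chartGen c j 0} ≤ 𝔴 := by
    rw [Ideal.span_le, Set.insert_subset_iff, Set.singleton_subset_iff]
    exact ⟨hcj𝔴, he0⟩
  have hker𝔴 : RingHom.ker θ ≤ 𝔴 := fun b hb => hspan𝔴 (hkerθ b hb)
  -- STEP 2: the image prime `𝔫 = θ(𝔴)` of `k[T]` is nonzero (emb.dim `R′ = 3`), `= (P̄)`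
  have h𝔴eq : (𝔴.map θ).comap θ = 𝔴 := by
    rw [Ideal.comap_map_of_surjective θ hθsurj, ← RingHom.ker_eq_comap_bot]
    exact sup_eq_left.mpr hker𝔴
  haveI h𝔫p : (𝔴.map θ).IsPrime := Ideal.map_isPrime_of_surjective hθsurj hker𝔴
  have h𝔫0 : 𝔴.map θ ≠ ⊥ := by
    intro h0
    have h1 : 𝔴 ≤ Ideal.span {chartBase c j (c j), chartGen c j 0} := fun b hb => hkerθ b (by
      have hb' : θ b ∈ 𝔴.map θ := Ideal.mem_map_of_mem _ hb
      rwa [h0, Ideal.mem_bot] at hb')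
    have h2 : maximalIdeal R' = Ideal.span {φ (c j), χ (chartGen c j 0)} := by
      refine le_antisymm ?_ ?_
      · rw [h𝔪']
        refine (Ideal.map_mono h1).trans (le_of_eq ?_)
        rw [Ideal.map_span, Set.image_insert_eq, Set.image_singleton, hχ]
      · rw [Ideal.span_le, Set.insert_subset_iff, Set.singleton_subset_iff, SetLike.mem_coe,
          SetLike.mem_coe, ← hχ, hχm, hχm]
        exact ⟨hcj𝔴, he0⟩
    have h3 := Submodule.spanFinrank_span_le_ncard_of_finite (R := R') (M := R')
      ((Set.finite_singleton (χ (chartGen c j 0))).insert (φ (c j)))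
    have h4 : ({φ (c j), χ (chartGen c j 0)} : Set R').ncard ≤ 2 :=
      (Set.ncard_insert_le _ _).trans (by rw [Set.ncard_singleton])
    have h5 : (maximalIdeal R').spanFinrank ≤ 2 := by rw [h2]; exact h3.trans h4
    omega
  -- `𝔴` is maximal: `𝔫 = θ(𝔴)` is a nonzero prime of the principal ideal domain `k[T]`
  haveI : (𝔴.map θ).IsMaximal := IsPrime.to_maximal_ideal h𝔫0
  haveI : 𝔴.IsMaximal := by rw [← h𝔴eq]; exact Ideal.comap_isMaximal_of_surjective θ hθsurj
  -- `R[T] → B_j/𝔴`, `G ↦ G(e_l)`, is onto (`ker θ ⊆ 𝔴`)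
  have hsurj : Function.Surjective ((Ideal.Quotient.mk 𝔴).comp
      (Polynomial.eval₂RingHom (chartBase c j) (chartGen c j l))) := by
    intro y
    obtain ⟨b, rfl⟩ := Ideal.Quotient.mk_surjective y
    obtain ⟨G, hG⟩ := Polynomial.map_surjective (residue R) residue_surjective (θ b)
    refine ⟨G, ?_⟩
    rw [RingHom.comp_apply, Polynomial.coe_eval₂RingHom, Ideal.Quotient.eq]
    refine hker𝔴 ?_
    rw [RingHom.mem_ker, map_sub θ (Polynomial.eval₂ (chartBase c j) (chartGen c j l) G) b, hθG, hG, sub_self]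
  have key := surjective_residue_comp_of_surjective_quotient_comp (S := R')
    (Polynomial.eval₂RingHom (chartBase c j) (chartGen c j l)) 𝔴 hsurj
  have hχP : ∀ G : Polynomial R, χ (Polynomial.eval₂ (chartBase c j) (chartGen c j l) G) =
      Polynomial.eval₂ φ (χ (chartGen c j l)) G := fun G => by
    rw [Polynomial.hom_eval₂, show χ.comp (chartBase c j) = φ from RingHom.ext hχ]
  intro r
  obtain ⟨G, hG⟩ := key r
  refine ⟨G, ?_⟩
  rw [← hG, RingHom.comp_apply, RingHom.comp_apply, Polynomial.coe_eval₂RingHom, ← hχP]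
  rfl

/-- **Transport of `k(R′) = k(R)[s̄]` to `k(R′) = k(R)[t̄]`, `t = s⁻¹`**, when `P′(t) ∈ 𝔪_{R′}` for some
`P′ ∈ R[T]` with unit constant term: `s ≡ −P′(0)⁻¹ · (P′ div T)(t)` modulo `𝔪_{R′}`, so `G(s) ≡ G(S(t))`.
[cite: CossartPiltant2008, Lemma 4.5 (2), (23)] -/
theorem residueField_generated_of_inv {R A : Type*} [CommRing R] [CommRing A] [IsLocalRing A]
    (φ : R →+* A) (sU : Aˣ) {P' : Polynomial R} (h0 : IsUnit (P'.coeff 0))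
    (hPt : P'.eval₂ φ ↑sU⁻¹ ∈ maximalIdeal A)
    (hκ : ∀ r : ResidueField A, ∃ G : Polynomial R, residue A (G.eval₂ φ ↑sU) = r) :
    ∀ r : ResidueField A, ∃ G : Polynomial R, residue A (G.eval₂ φ ↑sU⁻¹) = r := by
  obtain ⟨pU, hpU⟩ := h0
  -- `s ≡ S(t)` with `S = −P′(0)⁻¹ · (P′ div T)`
  have hdiv : Polynomial.X * P'.divX + Polynomial.C (P'.coeff 0) = P' := Polynomial.X_mul_divX_add P'
  have hS : residue A ↑sU = residue A ((-(Polynomial.C (↑pU⁻¹ : R) * P'.divX)).eval₂ φ ↑sU⁻¹) := by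
    have h1 : (↑sU⁻¹ : A) * P'.divX.eval₂ φ ↑sU⁻¹ + φ (P'.coeff 0) ∈ maximalIdeal A := by
      have h2 := congrArg (Polynomial.eval₂ φ (↑sU⁻¹ : A)) hdiv
      rw [Polynomial.eval₂_add, Polynomial.eval₂_mul, Polynomial.eval₂_X, Polynomial.eval₂_C] at h2
      rw [h2]; exact hPt
    have h3 : residue A ((↑sU⁻¹ : A) * P'.divX.eval₂ φ ↑sU⁻¹ + φ (P'.coeff 0)) = 0 :=
      (residue_eq_zero_iff _).mpr h1
    have hss : (↑sU : A) * ↑sU⁻¹ = 1 := Units.mul_inv _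
    have hpp : φ ↑pU⁻¹ * φ (P'.coeff 0) = 1 := by rw [← hpU, ← map_mul, Units.inv_mul, map_one]
    rw [Polynomial.eval₂_neg, Polynomial.eval₂_mul, Polynomial.eval₂_C]
    have h4 : (↑sU : A) = -(φ ↑pU⁻¹ * P'.divX.eval₂ φ ↑sU⁻¹) +
        ↑sU * φ ↑pU⁻¹ * ((↑sU⁻¹ : A) * P'.divX.eval₂ φ ↑sU⁻¹ + φ (P'.coeff 0)) := by
      linear_combination (-(↑sU : A)) * hpp - (φ ↑pU⁻¹ * P'.divX.eval₂ φ ↑sU⁻¹) * hss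
    conv_lhs => rw [h4]
    rw [map_add, map_mul (residue A) (↑sU * φ ↑pU⁻¹), h3, mul_zero, add_zero]
  intro r
  obtain ⟨G, hG⟩ := hκ r
  refine ⟨G.comp (-(Polynomial.C (↑pU⁻¹ : R) * P'.divX)), ?_⟩
  rw [Polynomial.eval₂_comp, ← hG, Polynomial.hom_eval₂ G φ (residue A), Polynomial.hom_eval₂ G φ (residue A), hS]

set_option maxHeartbeats 400000 in
-- many algebraic identities between units; moderate
/-- **Non-rational near point presented in the `u₂`-chart ⇒ `u₁`-chart presentation with the reciprocal
polynomial, carrying `k(R′) = k(R)[s̄] = k(R)[t̄]` along** (primed form of `chartSwitch_nonRational`). `φ : R → A` (`R`, `A` local), `φ u₀ = φ u₂ · y₂`, `φ u₁ = φ u₂ · s`, `P ∈ R[T]` monic with `P̄`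
irreducible of degree `≥ 2`, `G(s) ∈ 𝔪_A ⟺ P̄ ∣ Ḡ` for all `G`, `𝔪_A = (y₂, φ u₂, P(s))`. Then `s` is a
unit, and for `t = s⁻¹` and the monic reciprocal polynomial `P′ = P(0)⁻¹ T^d P(1/T)`: `P̄′` is irreducible
of degree `≥ 2`, `G(t) ∈ 𝔪_A ⟺ P̄′ ∣ Ḡ`, `𝔪_A = (t y₂, φ u₁, P′(t))`, and `(N : φ(u₂)^μ) = (N : φ(u₁)^μ)`.
[cite: CossartPiltant2008, Lemma 4.3 (5); proof of Prop. 4.4, p. 12] -/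
theorem chartSwitch_nonRational' {R A : Type*} [CommRing R] [IsLocalRing R] [CommRing A] [IsLocalRing A]
    (φ : R →+* A) {u₀ u₁ u₂ : R} {y₂ s : A} (h0 : φ u₀ = φ u₂ * y₂) (h1 : φ u₁ = φ u₂ * s)
    {P : Polynomial R} (hPm : P.Monic) (hP2 : 2 ≤ (P.map (residue R)).natDegree)
    (hPi : Irreducible (P.map (residue R)))
    (hcrit : ∀ G : Polynomial R, G.eval₂ φ s ∈ maximalIdeal A ↔
      P.map (residue R) ∣ G.map (residue R))
    (hgen : Ideal.span {y₂, φ u₂, P.eval₂ φ s} = maximalIdeal A)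
    (hκ : ∀ r : ResidueField A, ∃ G : Polynomial R, residue A (G.eval₂ φ s) = r) (N : Ideal A) (μ : ℕ) :
    ∃ (t : A) (P' : Polynomial R) (c' : Fin 3 → A), c' 1 = φ u₁ ∧ φ u₀ = φ u₁ * c' 0 ∧
      φ u₂ = φ u₁ * t ∧ P'.Monic ∧ c' 2 = P'.eval₂ φ t ∧ 2 ≤ (P'.map (residue R)).natDegree ∧
      Irreducible (P'.map (residue R)) ∧
      (∀ G : Polynomial R, G.eval₂ φ t ∈ maximalIdeal A ↔ P'.map (residue R) ∣ G.map (residue R)) ∧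
      Ideal.span {c' 0, c' 1, c' 2} = maximalIdeal A ∧
      Submodule.colon N ({φ u₂ ^ μ} : Set A) = Submodule.colon N ({φ u₁ ^ μ} : Set A) ∧
      (∀ r : ResidueField A, ∃ G : Polynomial R, residue A (G.eval₂ φ t) = r) := by
  have hdP : (P.map (residue R)).natDegree = P.natDegree := hPm.natDegree_map _
  -- `s` is a unit: `P̄ ∤ T`
  have hs : IsUnit s := by
    by_contra hns
    have hsm : (Polynomial.X : Polynomial R).eval₂ φ s ∈ maximalIdeal A := by
      rw [Polynomial.eval₂_X]; exact (IsLocalRing.mem_maximalIdeal s).mpr (mem_nonunits_iff.mpr hns)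
    have hdvd := (hcrit _).mp hsm
    rw [Polynomial.map_X] at hdvd
    have h := Polynomial.natDegree_le_of_dvd hdvd Polynomial.X_ne_zero
    rw [Polynomial.natDegree_X] at h; omega
  obtain ⟨sU, rfl⟩ := hs
  -- `P(0)` is a unit: `T ∤ P̄`
  have hPb0 : (P.map (residue R)).coeff 0 ≠ 0 := by
    intro h0
    obtain ⟨H, hH⟩ := Polynomial.X_dvd_iff.mpr h0
    rcases hPi.isUnit_or_isUnit hH with hX | hH1
    · exact Polynomial.not_isUnit_X hX
    · have h2 := Polynomial.natDegree_mul_le (p := (Polynomial.X : Polynomial (ResidueField R))) (q := H)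
      rw [← hH, Polynomial.natDegree_X, Polynomial.natDegree_eq_zero_of_isUnit hH1] at h2; omega
  have hp0 : IsUnit (P.coeff 0) := by
    refine (residue_ne_zero_iff_isUnit _).mp ?_
    rw [← Polynomial.coeff_map]; exact hPb0
  obtain ⟨pU, hpU⟩ := hp0
  -- the reciprocal polynomial
  set d := P.natDegree with hd
  have hRle : (P.reflect d).natDegree ≤ d := Polynomial.natDegree_reflect_le.trans (le_of_eq (max_self _))
  have hRcoef : (P.reflect d).coeff d = P.coeff 0 := by
    rw [Polynomial.coeff_reflect, Polynomial.revAt_le le_rfl, Nat.sub_self]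
  let P' : Polynomial R := Polynomial.C (↑pU⁻¹ : R) * P.reflect d
  have hP'le : P'.natDegree ≤ d :=
    (Polynomial.natDegree_C_mul_le _ _).trans hRle
  have hP'coef : P'.coeff d = 1 := by
    rw [Polynomial.coeff_C_mul, hRcoef, ← hpU, Units.inv_mul]
  have hP'm : P'.Monic := Polynomial.monic_of_natDegree_le_of_coeff_eq_one d hP'le hP'coef
  have hP'd : P'.natDegree = d :=
    le_antisymm hP'le (Polynomial.le_natDegree_of_ne_zero (by rw [hP'coef]; exact one_ne_zero))
  have hP'map : P'.map (residue R) = Polynomial.C (residue R ↑pU⁻¹) * (P.map (residue R)).reflect d := by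
    rw [Polynomial.map_mul, Polynomial.map_C, Polynomial.reflect_map]
  have hcU : IsUnit (Polynomial.C (residue R ↑pU⁻¹)) :=
    Polynomial.isUnit_C.mpr ((Units.map (residue R : R →* ResidueField R) pU⁻¹).isUnit)
  -- inverses
  letI : Invertible (↑sU : A) := sU.invertible
  have hinv : ⅟(↑sU : A) = ↑sU⁻¹ := invOf_units sU
  letI iT : Invertible (↑sU⁻¹ : A) := (sU⁻¹).invertible
  have hinv' : ⅟(↑sU⁻¹ : A) = ↑sU := by rw [invOf_units, inv_inv]
  -- `P(s) = (φ P(0) · s^d) · P′(s⁻¹)`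
  have hrefl : (P.reflect d).eval₂ φ ↑sU⁻¹ * ↑sU ^ d = P.eval₂ φ ↑sU := by
    rw [← hinv]; exact Polynomial.eval₂_reflect_mul_pow φ _ d P le_rfl
  have hPP' : P.eval₂ φ ↑sU = (φ ↑pU * ↑sU ^ d) * P'.eval₂ φ ↑sU⁻¹ := by
    rw [← hrefl, Polynomial.eval₂_mul, Polynomial.eval₂_C]
    have : φ (↑pU : R) * φ ↑pU⁻¹ = 1 := by rw [← map_mul, Units.mul_inv, map_one]
    linear_combination (-(Polynomial.eval₂ φ (↑sU⁻¹) (P.reflect d) * ↑sU ^ d)) * this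
  have hw : IsUnit (φ ↑pU * ↑sU ^ d : A) :=
    ((Units.map (φ : R →* A) pU).isUnit).mul (sU ^ d).isUnit
  -- the new criterion
  have hcrit' : ∀ G : Polynomial R, G.eval₂ φ ↑sU⁻¹ ∈ maximalIdeal A ↔
      P'.map (residue R) ∣ G.map (residue R) := by
    intro G
    have hG : (G.reflect G.natDegree).eval₂ φ ↑sU * ↑sU⁻¹ ^ G.natDegree = G.eval₂ φ ↑sU⁻¹ := by
      rw [← hinv']; exact Polynomial.eval₂_reflect_mul_pow φ _ G.natDegree G le_rfl
    rw [← hG, Ideal.mul_unit_mem_iff_mem _ ((sU⁻¹).isUnit.pow G.natDegree), hcrit, ← Polynomial.reflect_map,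
      Polynomial.dvd_reflect_iff_reflect_dvd (hPm.map _) hPb0 (Polynomial.natDegree_map_le), hdP, hP'map,
      IsUnit.mul_left_dvd hcU]
  have hP'2 : 2 ≤ (P'.map (residue R)).natDegree := by rw [hP'm.natDegree_map, hP'd, ← hdP]; exact hP2
  have hP'0 : IsUnit (P'.coeff 0) := by
    have h : P'.coeff 0 = ↑pU⁻¹ := by
      rw [Polynomial.coeff_C_mul, Polynomial.coeff_reflect, Polynomial.revAt_le (Nat.zero_le _),
        Nat.sub_zero, hPm.coeff_natDegree, mul_one]
    rw [h]; exact (pU⁻¹).isUnit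
  refine ⟨↑sU⁻¹, P', ![↑sU⁻¹ * y₂, φ u₁, P'.eval₂ φ ↑sU⁻¹], rfl, ?_, ?_, hP'm, rfl, hP'2,
    irreducible_map_residue_of_criterion φ _ (by omega) hcrit', hcrit', ?_, ?_,
    residueField_generated_of_inv φ sU hP'0 ((hcrit' P').mpr dvd_rfl) hκ⟩
  · show φ u₀ = φ u₁ * (↑sU⁻¹ * y₂)
    rw [h0, h1, mul_assoc, Units.mul_inv_cancel_left]
  · rw [h1, mul_assoc, Units.mul_inv, mul_one]
  · show Ideal.span {↑sU⁻¹ * y₂, φ u₁, P'.eval₂ φ ↑sU⁻¹} = maximalIdeal A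
    obtain ⟨wU, hwU⟩ := hw
    have e2 : φ u₁ = ↑sU * φ u₂ := by rw [h1, mul_comm]
    have e3 : P'.eval₂ φ ↑sU⁻¹ = ↑wU⁻¹ * P.eval₂ φ ↑sU := by
      rw [hPP', ← hwU, Units.inv_mul_cancel_left]
    rw [e2, e3, Ideal.span_triple_eq_of_isUnit_mul (sU⁻¹).isUnit sU.isUnit (wU⁻¹).isUnit, hgen]
  · have e : φ u₁ ^ μ = ↑(sU ^ μ) * φ u₂ ^ μ := by rw [h1, mul_pow, mul_comm, Units.val_pow_eq_pow_val]
    rw [e, Submodule.colon_singleton_eq_of_isUnit_mul N (sU ^ μ).isUnit]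

end Literature.AlgebraicGeometry.Resolution

end
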